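import Summits.CriticalPhenomena.PercolationContinuityZ3.Theorems.PercNearOneGluingNoHeavyLowerTailSahiTransportLast

/-!
# `NoHeavyLowerTail` (crux stmt-CriticalPhenomena-4575), Sahi / Kahn positivity: TRANSPORT CERTIFICATES (IV) —
# the signed (`σ`-form) certificate, a coupling-free proof of the extension theorem, and the quantitative Kahn bound

Support file (cell `prim-l12`, seat P3, gen 8; `--supports stmt-CriticalPhenomena-4575`).  No `sorry`, no named facts, standard axioms.
New mathematics (this programme's objects).

`…SahiTransportCert` / `…SahiTransportRho` prove Kahn's Conjecture 5 / Sahi's `C₃` for a junta first slot from a TRANSPORT CERTIFICATE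
(a kernel `Π`, or — via Strassen's coupling theorem — a probability vector `ρ` on the pattern event with (o), (a), (TC)).  Here we record
the form in which the certificate is simplest and in which its LINEAR-PROGRAMMING DUAL is cleanest: a single signed function `σ` on the
pattern cube (`SigmaCert`) with
  (i)   `σ ≤ κ` pointwise, `κ = (2 − θ)·w` on `H_k` and `−θ·w` off `H_k` (the `c`-coefficients of the section identity);
  (ii)  `Σ_S σ(S)·1_𝒴(S) ≥ 0` for every up-set `𝒴` (nonnegative on the monotone cone);
  (iii) `Σ_S σ(S)·1_{𝒳∩𝒵}(S) ≤ E₃^{cube}(1_{H_k}; 1_𝒳, 1_𝒵)` for all up-sets `𝒳, 𝒵`.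
* `sahiE_three_nonneg_of_sigmaCert`: a `σ`-certificate gives `E₃(1_H, 1_U, 1_V) ≥ 0` for all increasing `U, V` in every dimension.  The proof is
  five lines and uses NO coupling and NO kernel: with the outer sections `f, g` and outer covariances `c ≥ 0`, `e = fg + c` increasing,
  `E₃ = E₃^{cube}(f,g) + Σ κ c ≥ E₃^{cube}(f,g) + Σ σ c = E₃^{cube}(f,g) − Σ σ·fg + Σ σ·e ≥ 0` by (i), the bilinear cone lemma with (iii),
  and the cone lemma with (ii).
* `sigmaCert_of_transportCert`, `sigmaCert_of_rhoCert`: both earlier certificate forms are `σ`-certificates (`σ = Π(·ᶜ,·)−θw·1_{H_kᶜ}`,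
  resp. `σ = θδρ − θw·1_{H_kᶜ}`), so this file also gives a Strassen-free proof of `sahiE_three_nonneg_of_rhoCert`.
* `cubeForm_ind`: `E₃^{cube}` on a pair of up-set indicators in closed form, and `cubeForm_ind_eq_tcRHS_sub`: `E₃^{cube}(1_𝒳,1_𝒵) =
  tcRHS(𝒳,𝒵) − θ·w(H_kᶜ ∩ 𝒳 ∩ 𝒵)` (the transport condition (TC) is `θδ·ρ(𝒳∩𝒵) − θ·w(H_kᶜ∩𝒳∩𝒵) ≤ E₃^{cube}(1_{H_k};1_𝒳,1_𝒵)`).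
* **Quantitative Kahn inequality** `cubeForm_ind_ge_of_rhoCert`: a (`ρ`-form) certificate for `H_k` gives, inside the pattern cube,
  `E₃^{cube}(1_{H_k}; 1_𝒳, 1_𝒵) ≥ θ · w{S ∉ H_k, S ∉ 𝒳∩𝒵 : every T ⊇ S with T ∈ H_k lies in 𝒳 ∩ 𝒵}`  — the single-pair instance of
  the LP dual of the certificate programme (by LP duality the certificate EXISTS iff `Σ_j u_j E₃^{cube}(1_{H_k};1_{𝒳_j},1_{𝒵_j}) ≥
  Σ_S (φ − ψ)(S) κ'(S)` for all `u ≥ 0` and increasing `φ ≥ ψ := Σ_j u_j 1_{𝒳_j∩𝒵_j}`, `κ' = θw·1_{H_kᶜ} − (2−θ)w·1_{H_k}`; recorded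
  in the seat memo, not formalised).
Numerically (seat gen 8): the certificate polytope stays nonempty when the transport is restricted to MINIMAL completions (`T` minimal in
`H_k ∩ ↑S`) for all `28` types of `2^4`; for the threshold events `{|S| ≥ t}` the vector `ρ = μ(· | |S| = t)` is a certificate for `k ≤ 5` at
every parameter vector tested and for `k = 6` on `1.4·10^5` sampled pairs (capacity (a) fails only from `k = 22` on). [this work]
-/

noncomputable section

open scoped Classical

namespace Summit.CriticalPhenomena.PercolationContinuityZ3.Theorems

namespace SahiTransportCert

open Finset
open SahiHittingSlot
open Literature.Combinatorics.Sahi2008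
open Literature.Probability.Percolation (DeterminedBy determinedBy_iff)
open Literature.Probability.Percolation.BHK2006 (ind_inter)
open Literature.Probability.Percolation.DecisionTree (ind ind_of_mem ind_of_not_mem ind_nonneg)

variable {ι : Type} [Fintype ι] {k : ℕ}

/-! ### The bilinear form `E₃^{cube}(f,g) − Σ σ·fg` and its cone lemma -/

/-- The `σ`-remainder `B_σ(f,g) = E₃^{cube}(1_{H_k}; f, g) − Σ_S σ(S) f(S) g(S)`. [this work] -/
def sigForm (q : Fin k → unitInterval) (Hk : Set (Set (Fin k))) (σ : Set (Fin k) → ℝ) (f g : Set (Fin k) → ℝ) : ℝ :=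
  cubeForm q Hk f g - ∑ S, σ S * (f S * g S)

/-- `E₃^{cube}` is linear in the first pattern function. [this work] -/
theorem cubeForm_add_smul_left (q : Fin k → unitInterval) (Hk : Set (Set (Fin k))) (f f' g : Set (Fin k) → ℝ) (a : ℝ) :
    cubeForm q Hk (f + a • f') g = cubeForm q Hk f g + a * cubeForm q Hk f' g := by
  unfold cubeForm
  simp only [Pi.add_apply, Pi.smul_apply, smul_eq_mul]
  have eA : ∑ S, bernoulliWeight q S * (ind Hk S * ((f S + a * f' S) * g S)) =
      ∑ S, bernoulliWeight q S * (ind Hk S * (f S * g S)) + a * ∑ S, bernoulliWeight q S * (ind Hk S * (f' S * g S)) := by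
    rw [mul_sum, ← sum_add_distrib]; exact sum_congr rfl fun S _ => by ring
  have eB : ∑ S, bernoulliWeight q S * ((f S + a * f' S) * g S) =
      ∑ S, bernoulliWeight q S * (f S * g S) + a * ∑ S, bernoulliWeight q S * (f' S * g S) := by
    rw [mul_sum, ← sum_add_distrib]; exact sum_congr rfl fun S _ => by ring
  have eC : ∑ S, bernoulliWeight q S * (f S + a * f' S) =
      ∑ S, bernoulliWeight q S * f S + a * ∑ S, bernoulliWeight q S * f' S := by
    rw [mul_sum, ← sum_add_distrib]; exact sum_congr rfl fun S _ => by ring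
  have eD : ∑ S, bernoulliWeight q S * (ind Hk S * (f S + a * f' S)) =
      ∑ S, bernoulliWeight q S * (ind Hk S * f S) + a * ∑ S, bernoulliWeight q S * (ind Hk S * f' S) := by
    rw [mul_sum, ← sum_add_distrib]; exact sum_congr rfl fun S _ => by ring
  rw [eA, eB, eC, eD]
  ring

/-- `E₃^{cube}` is symmetric in the two pattern functions. [this work] -/
theorem cubeForm_comm (q : Fin k → unitInterval) (Hk : Set (Set (Fin k))) (f g : Set (Fin k) → ℝ) :
    cubeForm q Hk f g = cubeForm q Hk g f := by
  unfold cubeForm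
  have e1 : ∑ S, bernoulliWeight q S * (ind Hk S * (f S * g S)) = ∑ S, bernoulliWeight q S * (ind Hk S * (g S * f S)) :=
    sum_congr rfl fun S _ => by ring
  have e2 : ∑ S, bernoulliWeight q S * (f S * g S) = ∑ S, bernoulliWeight q S * (g S * f S) := sum_congr rfl fun S _ => by ring
  rw [e1, e2]
  ring

/-- `B_σ` is linear in the first slot. [this work] -/
theorem sigForm_add_smul_left (q : Fin k → unitInterval) (Hk : Set (Set (Fin k))) (σ : Set (Fin k) → ℝ)
    (f f' g : Set (Fin k) → ℝ) (a : ℝ) :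
    sigForm q Hk σ (f + a • f') g = sigForm q Hk σ f g + a * sigForm q Hk σ f' g := by
  unfold sigForm
  rw [cubeForm_add_smul_left]
  simp only [Pi.add_apply, Pi.smul_apply, smul_eq_mul]
  have e : ∑ S, σ S * ((f S + a * f' S) * g S) = ∑ S, σ S * (f S * g S) + a * ∑ S, σ S * (f' S * g S) := by
    rw [mul_sum, ← sum_add_distrib]; exact sum_congr rfl fun S _ => by ring
  rw [e]
  ring

/-- `B_σ` is symmetric. [this work] -/
theorem sigForm_comm (q : Fin k → unitInterval) (Hk : Set (Set (Fin k))) (σ : Set (Fin k) → ℝ) (f g : Set (Fin k) → ℝ) :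
    sigForm q Hk σ f g = sigForm q Hk σ g f := by
  unfold sigForm
  rw [cubeForm_comm]
  have e : ∑ S, σ S * (f S * g S) = ∑ S, σ S * (g S * f S) := sum_congr rfl fun S _ => by ring
  rw [e]

/-- On indicators, `B_σ(1_𝒳, 1_𝒵) = E₃^{cube}(1_𝒳,1_𝒵) − Σ σ·1_{𝒳∩𝒵}`. [this work] -/
theorem sigForm_ind (q : Fin k → unitInterval) (Hk : Set (Set (Fin k))) (σ : Set (Fin k) → ℝ) (𝒳 𝒵 : Set (Set (Fin k))) :
    sigForm q Hk σ (ind 𝒳) (ind 𝒵) = cubeForm q Hk (ind 𝒳) (ind 𝒵) - ∑ S, σ S * ind (𝒳 ∩ 𝒵) S := by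
  unfold sigForm
  congr 1
  exact sum_congr rfl fun S _ => by rw [ind_inter]

/-- The cone lemma for `B_σ`: nonnegativity on pairs of up-set indicators gives nonnegativity on pairs of increasing nonnegative pattern
functions. [this work] -/
theorem sigForm_nonneg_of_ind (q : Fin k → unitInterval) (Hk : Set (Set (Fin k))) (σ : Set (Fin k) → ℝ)
    (hind : ∀ 𝒳 𝒵 : Set (Set (Fin k)), IsUpperSet 𝒳 → IsUpperSet 𝒵 → 0 ≤ sigForm q Hk σ (ind 𝒳) (ind 𝒵))
    {f g : Set (Fin k) → ℝ} (hf : Monotone f) (hf0 : ∀ S, 0 ≤ f S) (hg : Monotone g) (hg0 : ∀ S, 0 ≤ g S) :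
    0 ≤ sigForm q Hk σ f g := by
  have step1 : ∀ 𝒳 : Set (Set (Fin k)), IsUpperSet 𝒳 → 0 ≤ sigForm q Hk σ g (ind 𝒳) := by
    intro 𝒳 h𝒳
    refine cone_of_upperSet (fun g' => sigForm q Hk σ g' (ind 𝒳)) (fun f₁ f₂ a => sigForm_add_smul_left q Hk σ f₁ f₂ _ a)
      (fun 𝒵 h𝒵 => ?_) g hg hg0
    rw [sigForm_comm]; exact hind 𝒳 𝒵 h𝒳 h𝒵
  refine cone_of_upperSet (fun f' => sigForm q Hk σ f' g) (fun f₁ f₂ a => sigForm_add_smul_left q Hk σ f₁ f₂ _ a)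
    (fun 𝒳 h𝒳 => ?_) f hf hf0
  rw [sigForm_comm]; exact step1 𝒳 h𝒳

/-- The one-slot cone lemma: a function `σ` which is nonnegative against every up-set indicator is nonnegative against every increasing
nonnegative pattern function. [this work] -/
theorem sum_mul_nonneg_of_upperSet (σ : Set (Fin k) → ℝ) (hup : ∀ 𝒴 : Set (Set (Fin k)), IsUpperSet 𝒴 → 0 ≤ ∑ S, σ S * ind 𝒴 S)
    {e : Set (Fin k) → ℝ} (he : Monotone e) (he0 : ∀ S, 0 ≤ e S) : 0 ≤ ∑ S, σ S * e S := by
  refine cone_of_upperSet (fun e' => ∑ S, σ S * e' S) (fun f₁ f₂ a => ?_) hup e he he0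
  simp only [Pi.add_apply, Pi.smul_apply, smul_eq_mul]
  rw [mul_sum, ← sum_add_distrib]
  exact sum_congr rfl fun S _ => by ring

/-! ### The signed certificate and the coupling-free extension theorem -/

/-- **A SIGNED (`σ`-form) TRANSPORT CERTIFICATE** for the up-set `Hk` of the pattern cube at the parameters `q` (`θ = w(Hk)`):
a function `σ` on patterns with (i) `σ(S) ≤ −θ·w(S)` off `Hk` and `σ(T) ≤ (2−θ)·w(T)` on `Hk`; (ii) `Σ σ·1_𝒴 ≥ 0` for every up-set `𝒴`;
(iii) `Σ σ·1_{𝒳∩𝒵} ≤ E₃^{cube}(1_{Hk}; 1_𝒳, 1_𝒵)` for all up-sets `𝒳, 𝒵`.  By LP duality this finite linear system is feasible exactly when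
the `ρ`-form system `RhoCert` is. [this work] -/
def SigmaCert (q : Fin k → unitInterval) (Hk : Set (Set (Fin k))) (σ : Set (Fin k) → ℝ) : Prop :=
  (∀ S, S ∉ Hk → σ S ≤ -(pr q Hk * bernoulliWeight q S)) ∧
  (∀ T, T ∈ Hk → σ T ≤ (2 - pr q Hk) * bernoulliWeight q T) ∧
  (∀ 𝒴 : Set (Set (Fin k)), IsUpperSet 𝒴 → 0 ≤ ∑ S, σ S * ind 𝒴 S) ∧
  (∀ 𝒳 𝒵 : Set (Set (Fin k)), IsUpperSet 𝒳 → IsUpperSet 𝒵 → ∑ S, σ S * ind (𝒳 ∩ 𝒵) S ≤ cubeForm q Hk (ind 𝒳) (ind 𝒵))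

/-- The pointwise bound (i) in one line: `σ(S) ≤ w(S)(2·1_{Hk}(S) − θ)`. [this work] -/
theorem SigmaCert.le_coef {q : Fin k → unitInterval} {Hk : Set (Set (Fin k))} {σ : Set (Fin k) → ℝ} (h : SigmaCert q Hk σ)
    (S : Set (Fin k)) : σ S ≤ bernoulliWeight q S * (2 * ind Hk S - pr q Hk) := by
  by_cases hS : S ∈ Hk
  · rw [ind_of_mem hS]; have := h.2.1 S hS; linarith
  · rw [ind_of_not_mem hS]; have := h.1 S hS; linarith

/-- **KAHN'S CONJECTURE 5 / SAHI'S `C₃` FROM A SIGNED CERTIFICATE** (coupling-free proof).  If the pattern event of the block-determined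
increasing event `H` carries a `σ`-certificate at the block parameters, then `E₃(1_H, 1_U, 1_V) ≥ 0` for ALL increasing `U, V` — every
dimension, the other two slots unrestricted. [this work] -/
theorem sahiE_three_nonneg_of_sigmaCert (p : ι → unitInterval) (e : Fin k ↪ ι) {H : Set (Set ι)}
    (hH : DeterminedBy H (Set.range e)) {σ : Set (Fin k) → ℝ} (hσ : SigmaCert (pk e p) (pat e H) σ)
    {U V : Set (Set ι)} (hU : IsUpperSet U) (hV : IsUpperSet V) :
    0 ≤ sahiE (bernoulliWeight p) 3 ![ind H, ind U, ind V] := by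
  set q := pk e p with hq
  set Hk := pat e H with hHk
  set f := fsec p e U with hf
  set g := fsec p e V with hg
  set c := csec p e U V with hc
  have hc0 : ∀ S, 0 ≤ c S := fun S => csec_nonneg p e hU hV S
  rw [sahiE_three_eq_cubeForm_add p e hH U V]
  change 0 ≤ cubeForm q Hk f g + ∑ S, bernoulliWeight q S * ((2 * ind Hk S - pr q Hk) * c S)
  -- (1) replace the `c`-coefficients by `σ` (pointwise, `c ≥ 0`)
  have h1 : ∑ S, σ S * c S ≤ ∑ S, bernoulliWeight q S * ((2 * ind Hk S - pr q Hk) * c S) := by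
    refine sum_le_sum fun S _ => ?_
    rw [← mul_assoc]
    exact mul_le_mul_of_nonneg_right (hσ.le_coef S) (hc0 S)
  -- (2) `Σ σ c = Σ σ e − Σ σ fg` with `e = fg + c` the (increasing, nonnegative) section of `U ∩ V`
  have h2 : ∑ S, σ S * c S = ∑ S, σ S * fsec p e (U ∩ V) S - ∑ S, σ S * (f S * g S) := by
    rw [← sum_sub_distrib]; exact sum_congr rfl fun S _ => by simp only [hc, csec, hf, hg]; ring
  -- (3) `Σ σ e ≥ 0` by the one-slot cone lemma and (ii)
  have h3 : 0 ≤ ∑ S, σ S * fsec p e (U ∩ V) S :=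
    sum_mul_nonneg_of_upperSet σ hσ.2.2.1 (fsec_mono p e (hU.inter hV)) (fun S => fsec_nonneg p e _ S)
  -- (4) `E₃^{cube}(f,g) − Σ σ fg ≥ 0` by the bilinear cone lemma and (iii)
  have h4 : 0 ≤ sigForm q Hk σ f g := by
    refine sigForm_nonneg_of_ind q Hk σ (fun 𝒳 𝒵 h𝒳 h𝒵 => ?_) (fsec_mono p e hU) (fun S => fsec_nonneg p e _ S)
      (fsec_mono p e hV) (fun S => fsec_nonneg p e _ S)
    rw [sigForm_ind]
    linarith [hσ.2.2.2 𝒳 𝒵 h𝒳 h𝒵]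
  unfold sigForm at h4
  linarith

/-! ### `E₃^{cube}` on indicators; both earlier certificate forms are `σ`-certificates -/

/-- `w(Hk ∩ 𝒴)` as a weighted indicator sum with the factor `1_{Hk}`. [this work] -/
theorem pr_inter_eq_sum_ind_mul (q : Fin k → unitInterval) (Hk 𝒴 : Set (Set (Fin k))) :
    pr q (Hk ∩ 𝒴) = ∑ S, bernoulliWeight q S * (ind Hk S * ind 𝒴 S) := by
  rw [pr_eq_sum]; exact sum_congr rfl fun S _ => by rw [ind_inter]

/-- `E₃^{cube}(1_{Hk}; 1_𝒳, 1_𝒵) = 2w(Hk∩𝒳∩𝒵) − θ·w(𝒳∩𝒵) − w(𝒳)w(Hk∩𝒵) − w(𝒵)w(Hk∩𝒳) + θ·w(𝒳)w(𝒵)`: Sahi's form on three up-sets of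
the pattern cube. [this work] -/
theorem cubeForm_ind (q : Fin k → unitInterval) (Hk 𝒳 𝒵 : Set (Set (Fin k))) :
    cubeForm q Hk (ind 𝒳) (ind 𝒵) = 2 * pr q (Hk ∩ (𝒳 ∩ 𝒵)) - pr q Hk * pr q (𝒳 ∩ 𝒵)
      - pr q 𝒳 * pr q (Hk ∩ 𝒵) - pr q 𝒵 * pr q (Hk ∩ 𝒳) + pr q Hk * (pr q 𝒳 * pr q 𝒵) := by
  unfold cubeForm
  have e1 : ∑ S, bernoulliWeight q S * (ind Hk S * (ind 𝒳 S * ind 𝒵 S)) = pr q (Hk ∩ (𝒳 ∩ 𝒵)) := by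
    rw [pr_inter_eq_sum_ind_mul]; exact sum_congr rfl fun S _ => by rw [ind_inter]
  have e2 : ∑ S, bernoulliWeight q S * (ind 𝒳 S * ind 𝒵 S) = pr q (𝒳 ∩ 𝒵) := by
    rw [pr_eq_sum]; exact sum_congr rfl fun S _ => by rw [ind_inter]
  rw [e1, e2, ← pr_eq_sum, ← pr_eq_sum, ← pr_inter_eq_sum_ind_mul, ← pr_inter_eq_sum_ind_mul]

/-- The transport right-hand side and Sahi's cube form differ by `θ·w(Hkᶜ ∩ 𝒳 ∩ 𝒵)`:
`E₃^{cube}(1_{Hk}; 1_𝒳, 1_𝒵) = tcRHS(𝒳,𝒵) − θ·w(Hkᶜ ∩ (𝒳 ∩ 𝒵))`. [this work] -/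
theorem cubeForm_ind_eq_tcRHS_sub (q : Fin k → unitInterval) (Hk 𝒳 𝒵 : Set (Set (Fin k))) :
    cubeForm q Hk (ind 𝒳) (ind 𝒵) = tcRHS q Hk 𝒳 𝒵 - pr q Hk * pr q (Hkᶜ ∩ (𝒳 ∩ 𝒵)) := by
  rw [cubeForm_ind, tcRHS, pr_compl_inter, pr_compl_inter, pr_compl_inter]
  ring

/-- **Kernel certificate ⇒ signed certificate**: `σ(T) = Σ_S Π(S,T) − θ·w(T)·1_{Hkᶜ}(T)` (column marginal minus the source mass). [this work] -/
theorem sigmaCert_of_transportCert {q : Fin k → unitInterval} {Hk : Set (Set (Fin k))} {Kr : Set (Fin k) → Set (Fin k) → ℝ}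
    (h : TransportCert q Hk Kr) :
    SigmaCert q Hk (fun T => (∑ S, Kr S T) - pr q Hk * bernoulliWeight q T * ind Hkᶜ T) := by
  set θ := pr q Hk with hθ
  have hrow0 : ∀ S, S ∈ Hk → ∀ T, Kr S T = 0 := fun S hS T => by
    by_contra hne; exact h.offH S T hne hS
  have hcol0 : ∀ T, T ∉ Hk → ∀ S, Kr S T = 0 := fun T hT S => by
    by_contra hne; exact hT (h.memH S T hne)
  have hrows : ∀ S, ∑ T, Kr S T = θ * bernoulliWeight q S * ind Hkᶜ S := by
    intro S
    by_cases hS : S ∈ Hk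
    · rw [sum_eq_zero fun T _ => hrow0 S hS T, ind_of_not_mem (show S ∉ Hkᶜ from fun h' => h' hS)]; ring
    · rw [h.row S hS, ind_of_mem (show S ∈ Hkᶜ from hS), mul_one]
  -- the signed functional against a pattern function: `Σ_T σ(T) φ(T) = Σ_{S,T} Π(S,T)(φ(T) − φ(S))`
  have hpair : ∀ φ : Set (Fin k) → ℝ, ∑ T, ((∑ S, Kr S T) - θ * bernoulliWeight q T * ind Hkᶜ T) * φ T =
      ∑ S, ∑ T, Kr S T * (φ T - φ S) := by
    intro φ
    have e1 : ∑ T, ((∑ S, Kr S T) - θ * bernoulliWeight q T * ind Hkᶜ T) * φ T =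
        ∑ T, (∑ S, Kr S T) * φ T - ∑ T, (∑ S, Kr T S) * φ T := by
      rw [← sum_sub_distrib]; exact sum_congr rfl fun T _ => by rw [hrows T]; ring
    have e2 : ∑ T, (∑ S, Kr S T) * φ T = ∑ S, ∑ T, Kr S T * φ T := by
      rw [sum_comm]; exact sum_congr rfl fun T _ => by rw [sum_mul]
    have e3 : ∑ T, (∑ S, Kr T S) * φ T = ∑ S, ∑ T, Kr S T * φ S :=
      sum_congr rfl fun T _ => by rw [sum_mul]
    rw [e1, e2, e3, ← sum_sub_distrib]
    refine sum_congr rfl fun S _ => ?_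
    rw [← sum_sub_distrib]
    exact sum_congr rfl fun T _ => by ring
  refine ⟨fun S hS => ?_, fun T hT => ?_, fun 𝒴 h𝒴 => ?_, fun 𝒳 𝒵 h𝒳 h𝒵 => ?_⟩
  · -- off `Hk`: the column vanishes, `σ(S) = −θ w(S)`
    show (∑ S', Kr S' S) - θ * bernoulliWeight q S * ind Hkᶜ S ≤ -(θ * bernoulliWeight q S)
    rw [sum_eq_zero fun S' _ => hcol0 S hS S', ind_of_mem (show S ∈ Hkᶜ from hS)]; linarith
  · -- on `Hk`: the column bound
    show (∑ S, Kr S T) - θ * bernoulliWeight q T * ind Hkᶜ T ≤ (2 - θ) * bernoulliWeight q T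
    rw [ind_of_not_mem (show T ∉ Hkᶜ from fun h' => h' hT), mul_zero, sub_zero]; exact h.col T
  · -- (ii): mass moves upwards
    rw [hpair]
    refine sum_nonneg fun S _ => sum_nonneg fun T _ => ?_
    by_cases hne : Kr S T = 0
    · rw [hne, zero_mul]
    · exact mul_nonneg (h.nonneg S T) (sub_nonneg.2 (ind_le_ind_of_imp fun hS => h𝒴 (h.subset S T hne) hS))
  · -- (iii): the transport condition
    rw [cubeForm_ind_eq_tcRHS_sub]
    have e1 : ∑ T, ((∑ S, Kr S T) - θ * bernoulliWeight q T * ind Hkᶜ T) * ind (𝒳 ∩ 𝒵) T =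
        ∑ S, ∑ T, Kr S T * ind (𝒳 ∩ 𝒵) T - θ * pr q (Hkᶜ ∩ (𝒳 ∩ 𝒵)) := by
      have : ∑ T, ((∑ S, Kr S T) - θ * bernoulliWeight q T * ind Hkᶜ T) * ind (𝒳 ∩ 𝒵) T =
          ∑ T, (∑ S, Kr S T) * ind (𝒳 ∩ 𝒵) T - θ * ∑ T, bernoulliWeight q T * (ind Hkᶜ T * ind (𝒳 ∩ 𝒵) T) := by
        rw [mul_sum, ← sum_sub_distrib]; exact sum_congr rfl fun T _ => by ring
      rw [this, ← pr_inter_eq_sum_ind_mul, sum_comm]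
      congr 1
      exact sum_congr rfl fun S _ => by rw [sum_mul]
    rw [e1]
    unfold tcRHS
    linarith [h.tc 𝒳 𝒵 h𝒳 h𝒵]

/-- **Reduced certificate ⇒ signed certificate**, WITHOUT Strassen's theorem: `σ = θδ·ρ − θ·w·1_{Hkᶜ}`. [this work] -/
theorem sigmaCert_of_rhoCert {q : Fin k → unitInterval} {Hk : Set (Set (Fin k))} {ρ : Set (Fin k) → ℝ} (h : RhoCert q Hk ρ) :
    SigmaCert q Hk (fun T => pr q Hk * (1 - pr q Hk) * ρ T - pr q Hk * bernoulliWeight q T * ind Hkᶜ T) := by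
  obtain ⟨_, hρH, _, ha, ho, htc⟩ := h
  set θ := pr q Hk with hθ
  have hθ0 : 0 ≤ θ := pr_nonneg q Hk
  have hsplit : ∀ 𝒴 : Set (Set (Fin k)), ∑ T, (θ * (1 - θ) * ρ T - θ * bernoulliWeight q T * ind Hkᶜ T) * ind 𝒴 T =
      θ * ((1 - θ) * ∑ T, ρ T * ind 𝒴 T) - θ * pr q (Hkᶜ ∩ 𝒴) := by
    intro 𝒴
    rw [pr_inter_eq_sum_ind_mul, mul_sum, mul_sum, mul_sum, ← sum_sub_distrib]
    exact sum_congr rfl fun T _ => by ring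
  refine ⟨fun S hS => ?_, fun T hT => ?_, fun 𝒴 h𝒴 => ?_, fun 𝒳 𝒵 h𝒳 h𝒵 => ?_⟩
  · show θ * (1 - θ) * ρ S - θ * bernoulliWeight q S * ind Hkᶜ S ≤ -(θ * bernoulliWeight q S)
    rw [hρH S hS, ind_of_mem (show S ∈ Hkᶜ from hS)]; linarith
  · show θ * (1 - θ) * ρ T - θ * bernoulliWeight q T * ind Hkᶜ T ≤ (2 - θ) * bernoulliWeight q T
    rw [ind_of_not_mem (show T ∉ Hkᶜ from fun h' => h' hT), mul_zero, sub_zero]; exact ha T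
  · rw [hsplit, ← mul_sub]
    exact mul_nonneg hθ0 (sub_nonneg.2 (ho 𝒴 h𝒴))
  · rw [hsplit, cubeForm_ind_eq_tcRHS_sub, ← mul_assoc]
    linarith [htc 𝒳 𝒵 h𝒳 h𝒵]

/-- Kahn / Sahi positivity from a reduced certificate, now WITHOUT the coupling step (compare `sahiE_three_nonneg_of_rhoCert`). [this work] -/
theorem sahiE_three_nonneg_of_rhoCert' (p : ι → unitInterval) (e : Fin k ↪ ι) {H : Set (Set ι)}
    (hH : DeterminedBy H (Set.range e)) {ρ : Set (Fin k) → ℝ} (hρ : RhoCert (pk e p) (pat e H) ρ)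
    {U V : Set (Set ι)} (hU : IsUpperSet U) (hV : IsUpperSet V) :
    0 ≤ sahiE (bernoulliWeight p) 3 ![ind H, ind U, ind V] :=
  sahiE_three_nonneg_of_sigmaCert p e hH (sigmaCert_of_rhoCert hρ) hU hV

/-! ### The quantitative Kahn inequality of a certificate -/

/-- The TRAPPED patterns of the pair `(𝒳, 𝒵)`: patterns outside `Hk` and outside `𝒳 ∩ 𝒵` all of whose completions in `Hk` lie in
`𝒳 ∩ 𝒵`. [this work] -/
def trapped (Hk 𝒳 𝒵 : Set (Set (Fin k))) : Set (Set (Fin k)) :=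
  {S | S ∉ Hk ∧ S ∉ 𝒳 ∩ 𝒵 ∧ ∀ T, S ⊆ T → T ∈ Hk → T ∈ 𝒳 ∩ 𝒵}

/-- **QUANTITATIVE KAHN INEQUALITY FROM A CERTIFICATE.**  If `Hk` carries a transport certificate at `q`, then for all up-sets `𝒳, 𝒵` of
the pattern cube `E₃^{cube}(1_{Hk}; 1_𝒳, 1_𝒵) ≥ θ · w(trapped)`: every source whose whole transport is forced into `𝒳 ∩ 𝒵` contributes
its full row `θ·w(S)` to the left side of (TC).  (The single-pair instance of the LP dual of the certificate programme.) [this work] -/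
theorem cubeForm_ind_ge_of_transportCert {q : Fin k → unitInterval} {Hk : Set (Set (Fin k))} {Kr : Set (Fin k) → Set (Fin k) → ℝ}
    (h : TransportCert q Hk Kr) {𝒳 𝒵 : Set (Set (Fin k))} (h𝒳 : IsUpperSet 𝒳) (h𝒵 : IsUpperSet 𝒵) :
    pr q Hk * pr q (trapped Hk 𝒳 𝒵) ≤ cubeForm q Hk (ind 𝒳) (ind 𝒵) := by
  set θ := pr q Hk with hθ
  have hcol0 : ∀ T, T ∉ Hk → ∀ S, Kr S T = 0 := fun T hT S => by
    by_contra hne; exact hT (h.memH S T hne)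
  -- every source in `trapped ∪ (Hkᶜ ∩ 𝒳 ∩ 𝒵)` sends its whole row into `𝒳 ∩ 𝒵`
  have key : ∀ S, θ * bernoulliWeight q S * (ind (trapped Hk 𝒳 𝒵) S + ind (Hkᶜ ∩ (𝒳 ∩ 𝒵)) S) ≤ ∑ T, Kr S T * ind (𝒳 ∩ 𝒵) T := by
    intro S
    by_cases hS : S ∈ Hk
    · rw [ind_of_not_mem (show S ∉ trapped Hk 𝒳 𝒵 from fun h' => h'.1 hS),
        ind_of_not_mem (show S ∉ Hkᶜ ∩ (𝒳 ∩ 𝒵) from fun h' => h'.1 hS), add_zero, mul_zero]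
      exact sum_nonneg fun T _ => mul_nonneg (h.nonneg S T) (ind_nonneg _ T)
    · by_cases hin : S ∈ trapped Hk 𝒳 𝒵 ∨ S ∈ 𝒳 ∩ 𝒵
      · -- full row
        have hall : ∀ T, Kr S T * ind (𝒳 ∩ 𝒵) T = Kr S T := by
          intro T
          by_cases hne : Kr S T = 0
          · rw [hne, zero_mul]
          · have hT : T ∈ 𝒳 ∩ 𝒵 := by
              rcases hin with h1 | h2
              · exact h1.2.2 T (h.subset S T hne) (h.memH S T hne)
              · exact ⟨h𝒳 (h.subset S T hne) h2.1, h𝒵 (h.subset S T hne) h2.2⟩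
            rw [ind_of_mem hT, mul_one]
        rw [sum_congr rfl fun T _ => hall T, h.row S hS]
        have hle : ind (trapped Hk 𝒳 𝒵) S + ind (Hkᶜ ∩ (𝒳 ∩ 𝒵)) S ≤ 1 := by
          rcases hin with h1 | h2
          · rw [ind_of_mem h1, ind_of_not_mem (show S ∉ Hkᶜ ∩ (𝒳 ∩ 𝒵) from fun h' => h1.2.1 h'.2)]; norm_num
          · rw [ind_of_not_mem (show S ∉ trapped Hk 𝒳 𝒵 from fun h' => h'.2.1 h2), ind_of_mem (show S ∈ Hkᶜ ∩ (𝒳 ∩ 𝒵) from ⟨hS, h2⟩)]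
            norm_num
        calc θ * bernoulliWeight q S * (ind (trapped Hk 𝒳 𝒵) S + ind (Hkᶜ ∩ (𝒳 ∩ 𝒵)) S)
            ≤ θ * bernoulliWeight q S * 1 :=
              mul_le_mul_of_nonneg_left hle (mul_nonneg (pr_nonneg q Hk) (bw_nonneg q S))
          _ = pr q Hk * bernoulliWeight q S := by rw [mul_one]
      · simp only [not_or] at hin
        rw [ind_of_not_mem hin.1, ind_of_not_mem (show S ∉ Hkᶜ ∩ (𝒳 ∩ 𝒵) from fun h' => hin.2 h'.2), add_zero, mul_zero]
        exact sum_nonneg fun T _ => mul_nonneg (h.nonneg S T) (ind_nonneg _ T)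
  have hsum : θ * pr q (trapped Hk 𝒳 𝒵) + θ * pr q (Hkᶜ ∩ (𝒳 ∩ 𝒵)) ≤ ∑ S, ∑ T, Kr S T * ind (𝒳 ∩ 𝒵) T := by
    rw [pr_eq_sum, pr_eq_sum q (Hkᶜ ∩ (𝒳 ∩ 𝒵)), mul_sum, mul_sum, ← sum_add_distrib]
    refine sum_le_sum fun S _ => ?_
    have := key S
    linarith [this]
  rw [cubeForm_ind_eq_tcRHS_sub]
  unfold tcRHS
  linarith [h.tc 𝒳 𝒵 h𝒳 h𝒵]

/-- The quantitative Kahn inequality from a reduced (`ρ`-form) certificate. [this work] -/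
theorem cubeForm_ind_ge_of_rhoCert {q : Fin k → unitInterval} {Hk : Set (Set (Fin k))} {ρ : Set (Fin k) → ℝ} (h : RhoCert q Hk ρ)
    {𝒳 𝒵 : Set (Set (Fin k))} (h𝒳 : IsUpperSet 𝒳) (h𝒵 : IsUpperSet 𝒵) :
    pr q Hk * pr q (trapped Hk 𝒳 𝒵) ≤ cubeForm q Hk (ind 𝒳) (ind 𝒵) := by
  obtain ⟨Kr, hKr⟩ := exists_transportCert_of_rhoCert h
  exact cubeForm_ind_ge_of_transportCert hKr h𝒳 h𝒵

/-- **Under the transport-certificate conjecture, Kahn's inequality holds in the QUANTITATIVE form**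
`E₃^{cube}(1_{Hk}; 1_𝒳, 1_𝒵) ≥ w(Hk) · w(trapped)` for all up-sets `Hk, 𝒳, 𝒵` of every pattern cube. [this work] -/
theorem cubeForm_ind_ge_of_transportCertConjecture (hT : TransportCertConjecture) (q : Fin k → unitInterval)
    {Hk 𝒳 𝒵 : Set (Set (Fin k))} (hHk : IsUpperSet Hk) (h𝒳 : IsUpperSet 𝒳) (h𝒵 : IsUpperSet 𝒵) :
    pr q Hk * pr q (trapped Hk 𝒳 𝒵) ≤ cubeForm q Hk (ind 𝒳) (ind 𝒵) := by
  obtain ⟨Kr, hKr⟩ := hT k q Hk hHk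
  exact cubeForm_ind_ge_of_transportCert hKr h𝒳 h𝒵

end SahiTransportCert

end Summit.CriticalPhenomena.PercolationContinuityZ3.Theorems
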